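/-
Copyright (c) 2026. All rights reserved.
Released under Apache 2.0 license as described in the file LICENSE.
Authors: abc-iut cell, wave-2 prover seat abc-iut-L5-t15.
-/
import Literature.IUT.LogVolume.DifferentEstimatesProofs
import HarnessLib

/-!
# [IUTchIV] Proposition 1.3 — corollaries in the form used downstream

Mochizuki, *Inter-universal Teichmüller theory IV*, RIMS manuscript (Apr. 2020), §1: the estimates
of differents are USED in the forms (a) "`d_i ≥ (e_i - 1)/e_i` for all `i ∈ I` [cf. Proposition
1.3, (i)]" (proof of Prop. 1.4 (iii), kurims p. 14, with `k_0 = ℚ_p`), and (b) at a single prime of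
a tower `ℚ_p ⊆ k₀ ⊆ K`: `d₀ ≤ d_K`, the tame equality, and `d_K ≤ d₀ + n + 1/e₀` (proof of
Thm. 1.10, Step (ii), kurims p. 24). THEOREMS ONLY (no definition, no named fact), over
`DifferentEstimatesProofs.lean` (`prop13i_holds`, `prop13ii_holds`).

* Absolute case `k₀ = ℚ_p` (Serre, *Corps locaux* III §6 Prop. 13 in the cell's normalisation
  `ord(p) = 1`, `𝔇(𝒪_K/ℤ_p) = 𝔪^δ`, `d = δ/e`): `maximalIdeal_pow_sub_one_dvd_different`
  (`𝔪^{e-1} ∣ 𝔇`), `exists_different_generator_exponent` (`δ ≥ e - 1`; `δ = e - 1` iff `p ∤ e`;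
  `δ ≥ e` if `p ∣ e`), **`sub_one_div_le_differentOrd`** (`(e-1)/e ≤ d`),
  `differentOrd_eq_of_not_dvd` (`p ∤ e ⇒ d = (e-1)/e`), `one_le_differentOrd_of_dvd`
  (`p ∣ e ⇒ 1 ≤ d`).
* Relative case: `differentOrd_base_le` (`d₀ ≤ d_K`), `differentOrd_lt`
  (`d_K < d₀ + 1/e₀ + v_p([K : k₀])`, no tameness / Galois hypothesis),
  `differentOrd_eq_of_isTamelyRamified` (`d_K = d₀ + 1/e₀ - 1/e_K`).

Nothing here is disputed mathematics; the [IUTchIV] locators record the cell's typing.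
-/

noncomputable section

open Metric Set IsLocalRing Module
open scoped NormedField

namespace Literature.IUT.LogVolume

open Literature.NumberTheory.GaloisRepresentations.Ultrametric (exists_norm_eq_pow_of_norm_le_one)
open Literature.NumberTheory.NumberFields (pow_dvd_differentIdeal_iff_natCast_ramificationIdx_mem)

variable (p : ℕ) [Fact p.Prime]
variable (k₀ : Type*) [NontriviallyNormedField k₀] [inst₀ : NormedAlgebra ℚ_[p] k₀]
  [IsUltrametricDist k₀] [ProperSpace k₀]
variable (K : Type*) [NontriviallyNormedField K] [instK : NormedAlgebra ℚ_[p] K]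
  [IsUltrametricDist K] [ProperSpace K]

/-! ## The absolute case `k₀ = ℚ_p` -/

/-- `𝔪^{e-1} ∣ 𝔇(𝒪_K/ℤ_p)` (Mathlib's `pow_sub_one_dvd_differentIdeal` with `p 𝒪_K = 𝔪^e`).
[cite: SerreLocalFields1979, Ch. III §6 Prop. 13] -/
theorem maximalIdeal_pow_sub_one_dvd_different :
    maximalIdeal (Valued.integer K) ^ (absRamificationIdx p K - 1) ∣ different p K := by
  haveI := isSeparable_fractionRing p K
  exact pow_sub_one_dvd_differentIdeal ℤ_[p] (p := maximalIdeal ℤ_[p])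
    (maximalIdeal (Valued.integer K)) _ (IsDiscreteValuationRing.not_a_field _)
    (by rw [map_maximalIdeal_padicInt p K])

/-- `(n : ℤ_p) ∈ 𝔪_{ℤ_p} ↔ p ∣ n`. [folklore] -/
private theorem natCast_mem_maximalIdeal_padicInt_iff (n : ℕ) :
    (n : ℤ_[p]) ∈ maximalIdeal ℤ_[p] ↔ p ∣ n := by
  rw [PadicInt.maximalIdeal_eq_span_p, Ideal.mem_span_singleton, ← PadicInt.norm_lt_one_iff_dvd,
    ← Int.cast_natCast, PadicInt.norm_int_lt_one_iff_dvd, Int.natCast_dvd_natCast]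

/-- `𝔪^e` lies over `𝔪_{ℤ_p}` (`p 𝒪_K = 𝔪^e`). [folklore] -/
private theorem liesOver_maximalIdeal_pow_padicInt :
    (maximalIdeal (Valued.integer K) ^ absRamificationIdx p K).LiesOver (maximalIdeal ℤ_[p]) := by
  refine ⟨(IsLocalRing.maximalIdeal.isMaximal ℤ_[p]).eq_of_le ?_ ?_⟩
  · refine Ideal.comap_ne_top _ (ne_top_of_le_ne_top ?_
      (Ideal.pow_le_self (absRamificationIdx_pos p K).ne'))
    exact (IsLocalRing.maximalIdeal.isMaximal (Valued.integer K)).ne_top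
  · rw [Ideal.under_def, ← map_maximalIdeal_padicInt p K]
    exact Ideal.le_comap_map

/-- **The exponent `δ` of the different, `𝔇(𝒪_K/ℤ_p) = 𝔪^δ`**: `d = δ/e`, `δ ≥ e - 1`, with
`δ = e - 1` iff `p ∤ e` and `δ ≥ e` if `p ∣ e` (Serre, *Corps locaux* III §6 Prop. 13, from
Mathlib's lower bound and the tree's `pow_dvd_differentIdeal_iff_natCast_ramificationIdx_mem`).
[cite: SerreLocalFields1979, Ch. III §6 Prop. 13] -/
theorem exists_different_generator_exponent {ϖ : Valued.integer K} (hϖ : Irreducible ϖ) :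
    ∃ g : Valued.integer K, ∃ δ : ℕ, different p K = Ideal.span {g} ∧
      ‖(g : K)‖ = ‖(ϖ : K)‖ ^ δ ∧ differentOrd p K = (δ : ℝ) / absRamificationIdx p K ∧
      absRamificationIdx p K - 1 ≤ δ ∧
      (¬ p ∣ absRamificationIdx p K → δ = absRamificationIdx p K - 1) ∧
      (p ∣ absRamificationIdx p K → absRamificationIdx p K ≤ δ) := by
  obtain ⟨g, hg⟩ := exists_different_eq_span p K
  have hg0 : (g : K) ≠ 0 := fun h ↦ generator_ne_zero p K hg (Subtype.ext h)
  obtain ⟨δ, hδ⟩ := exists_norm_eq_pow_of_norm_le_one hϖ (g : K) hg0 (Valued.integer.norm_le_one g)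
  have hϖ1 : ‖(ϖ : K)‖ < 1 := Valued.integer.norm_irreducible_lt_one hϖ
  have hϖ0 : 0 < ‖(ϖ : K)‖ := Valued.integer.norm_irreducible_pos hϖ
  have hlow := maximalIdeal_pow_sub_one_dvd_different p K
  rw [hg, maximalIdeal_pow_dvd_span_singleton_iff K hϖ, hδ,
    pow_le_pow_iff_right_of_lt_one₀ hϖ0 hϖ1] at hlow
  -- Serre's criterion `𝔪^e ∣ 𝔇 ↔ p ∣ e`, over `ℤ_p ⊆ 𝒪_K`
  have key : maximalIdeal (Valued.integer K) ^ absRamificationIdx p K ∣ different p K ↔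
      p ∣ absRamificationIdx p K := by
    haveI := finiteDimensional p K
    haveI : Algebra.IsAlgebraic ℚ_[p] K := Algebra.IsAlgebraic.of_finite ℚ_[p] K
    haveI : Algebra.IsSeparable ℚ_[p] K := inferInstance
    haveI := liesOver_maximalIdeal p K
    haveI := liesOver_maximalIdeal_pow_padicInt p K
    letI := Ideal.Quotient.field (maximalIdeal ℤ_[p])
    letI := Ideal.Quotient.field (maximalIdeal (Valued.integer K))
    haveI : Finite (ℤ_[p] ⧸ maximalIdeal ℤ_[p]) :=
      Finite.of_equiv _ (PadicInt.residueField (p := p)).toEquiv.symm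
    haveI : Algebra.IsAlgebraic (ℤ_[p] ⧸ maximalIdeal ℤ_[p])
        (Valued.integer K ⧸ maximalIdeal (Valued.integer K)) :=
      Algebra.IsAlgebraic.of_finite _ _
    rw [different_eq, pow_dvd_differentIdeal_iff_natCast_ramificationIdx_mem ℤ_[p] ℚ_[p] K
      (Valued.integer K) (IsDiscreteValuationRing.not_a_field _) (maximalIdeal (Valued.integer K))
      (absRamificationIdx_pos p K).ne' (I := ⊤)
      (by rw [Ideal.mul_top, map_maximalIdeal_padicInt p K])
      (by rw [sup_top_eq]), natCast_mem_maximalIdeal_padicInt_iff]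
  rw [hg, maximalIdeal_pow_dvd_span_singleton_iff K hϖ, hδ,
    pow_le_pow_iff_right_of_lt_one₀ hϖ0 hϖ1] at key
  refine ⟨g, δ, hg, hδ, ?_, hlow, fun hnd ↦ ?_, fun hd ↦ key.mpr hd⟩
  · rw [differentOrd_eq_of_span p K hg]
    exact neg_logb_norm_eq_div p K hϖ hδ
  · have := mt key.mp hnd
    omega

/-- **`(e - 1)/e ≤ d`** — "`d_i ≥ (e_i - 1)/e_i` for all `i ∈ I` [cf. Proposition 1.3, (i)]"
([IUTchIV] proof of Prop. 1.4 (iii), kurims p. 14: the case `k_0 = ℚ_p` of Prop. 1.3 (i)).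
[claim: Mochizuki2012, status: disputed] -/
theorem sub_one_div_le_differentOrd :
    ((absRamificationIdx p K : ℝ) - 1) / absRamificationIdx p K ≤ differentOrd p K := by
  obtain ⟨ϖ, hϖ⟩ := IsDiscreteValuationRing.exists_irreducible (Valued.integer K)
  obtain ⟨-, δ, -, -, hd, hlow, -, -⟩ := exists_different_generator_exponent p K hϖ
  have he := absRamificationIdx_pos p K
  have hcast : ((absRamificationIdx p K : ℝ) - 1) = ((absRamificationIdx p K - 1 : ℕ) : ℝ) := by
    rw [Nat.cast_sub he, Nat.cast_one]
  have hδ : ((absRamificationIdx p K - 1 : ℕ) : ℝ) ≤ δ := by exact_mod_cast hlow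
  rw [hd, hcast]
  gcongr

/-- **Tame absolute case: `p ∤ e ⇒ d = (e - 1)/e`.**
[cite: SerreLocalFields1979, Ch. III §6 Prop. 13] -/
theorem differentOrd_eq_of_not_dvd (h : ¬ p ∣ absRamificationIdx p K) :
    differentOrd p K = ((absRamificationIdx p K : ℝ) - 1) / absRamificationIdx p K := by
  obtain ⟨ϖ, hϖ⟩ := IsDiscreteValuationRing.exists_irreducible (Valued.integer K)
  obtain ⟨-, δ, -, -, hd, -, htame, -⟩ := exists_different_generator_exponent p K hϖ
  rw [hd, htame h, Nat.cast_sub (absRamificationIdx_pos p K), Nat.cast_one]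

/-- **Wild absolute case: `p ∣ e ⇒ 1 ≤ d`.** [cite: SerreLocalFields1979, Ch. III §6 Prop. 13] -/
theorem one_le_differentOrd_of_dvd (h : p ∣ absRamificationIdx p K) : 1 ≤ differentOrd p K := by
  obtain ⟨ϖ, hϖ⟩ := IsDiscreteValuationRing.exists_irreducible (Valued.integer K)
  obtain ⟨-, δ, -, -, hd, -, -, hwild⟩ := exists_different_generator_exponent p K hϖ
  have he : (0 : ℝ) < absRamificationIdx p K := by exact_mod_cast absRamificationIdx_pos p K
  have hδ : (absRamificationIdx p K : ℝ) ≤ δ := by exact_mod_cast hwild h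
  rw [hd, le_div_iff₀ he, one_mul]
  exact hδ

/-! ## The relative case `ℚ_p ⊆ k₀ ⊆ K` -/

variable [NormedAlgebra k₀ K]

/-- **`d₀ ≤ d_K`**: the order of the different does not decrease in an extension
([IUTchIV] Prop 1.3 (i); used in Thm 1.10 Step (ii) as
"`log(𝔡^{F_tpd}) + log(𝔣^{F_tpd}) ≤ log(𝔡^F) + log(𝔣^F)`").
[claim: Mochizuki2012, status: disputed] -/
theorem differentOrd_base_le [IsScalarTower ℚ_[p] k₀ K] : differentOrd p k₀ ≤ differentOrd p K := by
  obtain ⟨hle, -⟩ := prop13i_holds p k₀ K ‹_›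
  have he' := relRamificationIdx_pos p k₀ K
  have h1 : (1 : ℝ) ≤ relRamificationIdx p k₀ K := by exact_mod_cast he'
  have h0 : 0 ≤ ((relRamificationIdx p k₀ K : ℝ) - 1) / absRamificationIdx p K :=
    div_nonneg (by linarith) (Nat.cast_nonneg _)
  linarith

/-- **`d_K < d₀ + 1/e₀ + v_p([K : k₀])`** for ANY `ℚ_p ⊆ k₀ ⊆ K` (Lenstra's bound; the case
`k₁ = k₀` of [IUTchIV] Prop 1.3 (ii), sharpened to a strict inequality and without the Galois
hypothesis). [claim: Mochizuki2012, status: disputed] -/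
theorem differentOrd_lt [IsScalarTower ℚ_[p] k₀ K] :
    differentOrd p K < differentOrd p k₀ + 1 / (absRamificationIdx p k₀ : ℝ) +
      padicValNat p (Module.finrank k₀ K) := by
  obtain ⟨ϖ₀, hϖ₀⟩ := IsDiscreteValuationRing.exists_irreducible (Valued.integer k₀)
  obtain ⟨ϖ, hϖ⟩ := IsDiscreteValuationRing.exists_irreducible (Valued.integer K)
  obtain ⟨h, j, hh, hj, hd, -, -⟩ := exists_generator_exponent p k₀ K hϖ
  have hlen := norm_finrank_mul_norm_lt_norm_generator p k₀ K hh hϖ₀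
  have hp1 : (1 : ℝ) < p := by exact_mod_cast (Fact.out : p.Prime).one_lt
  have hp0 : (0 : ℝ) < p := by positivity
  haveI := finiteDimensional_rel p k₀ K
  have hn0 : Module.finrank k₀ K ≠ 0 := (Module.finrank_pos (R := k₀) (M := K)).ne'
  rw [hj, norm_irreducible_pow_eq p K hϖ, norm_natCast_eq_rpow_neg p k₀ hn0,
    norm_irreducible_eq p k₀ hϖ₀, ← Real.rpow_add hp0, Real.rpow_lt_rpow_left_iff hp1] at hlen
  rw [hd]
  linarith

/-- **Tame case: `d_K = d₀ + 1/e₀ - 1/e_K`** (since `e' = e_K/e₀`), in particular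
`d_K < d₀ + 1/e₀` ([IUTchIV] Prop 1.3 (i), equality case; used in Thm 1.10 Step (ii) "at the primes
that do not divide `2·3·5`" / "`l`"). [claim: Mochizuki2012, status: disputed] -/
theorem differentOrd_eq_of_isTamelyRamified [IsScalarTower ℚ_[p] k₀ K]
    (htame : IsTamelyRamified p k₀ K) :
    differentOrd p K = differentOrd p k₀ + 1 / (absRamificationIdx p k₀ : ℝ) -
      1 / (absRamificationIdx p K : ℝ) := by
  obtain ⟨-, heq⟩ := prop13i_holds p k₀ K ‹_›
  have hmul : (relRamificationIdx p k₀ K : ℝ) * absRamificationIdx p k₀ =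
      absRamificationIdx p K := by
    exact_mod_cast relRamificationIdx_mul p k₀ K
  have he₀ : (absRamificationIdx p k₀ : ℝ) ≠ 0 := by
    exact_mod_cast (absRamificationIdx_pos p k₀).ne'
  have he : (absRamificationIdx p K : ℝ) ≠ 0 := by exact_mod_cast (absRamificationIdx_pos p K).ne'
  rw [heq htame]
  field_simp
  linarith


end Literature.IUT.LogVolume

end
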